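import Mathlib
import HarnessLib
import Summits.Ventures.LatticeQCDFlow.Scoring.GeometricEnvelopeBlockSumSharp
import Summits.Ventures.LatticeQCDFlow.Scoring.BlockSumLeadingBias

/-!
# The EXACT leading constant of the bias of a squared block sum, from any start, under a geometric
# sup-norm envelope: `|E_{μ₀}[(Σ_{t<n} f̄(X_{s+t}))²] − (n σ²_f − 2 Γ_f)| ≤ 16 C² A² (1+ρ) ρ^s/(1−ρ)² + 16 C² A ρ^{n+1}/(1−ρ)²`

HONEST FRAMING: exact (Metropolis-corrected) sampling algorithms for lattice gauge theory;
figures of merit are autocorrelation/cost numbers at stated couplings and volumes; no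
continuum-physics claim.

Venture `LatticeQCDFlow` (cell pub-lqcd), topic `Scoring`; FANOUT row 8 (`s0-cpn-nemc`, GEN-21).
NEW WORK of the cell, not a published result; no definition is introduced; nothing is cited as a
fact.  `Scoring/GeometricEnvelopeBlockSumSharp.lean` proved `|E_{μ₀}[S_{s,n}²] − n σ²_f| ≤
32 C² A (A+1)/(1−ρ)²` uniformly in the start and the block position and left the leading constant
of that `O(1)` as NOT CLAIMED.  It is `−2 Γ_f`, `Γ_f = Σ_{k≥1} k γ_k = Σ' k, (k+1) γ_{k+1}`
(`γ_k = autocov κ π f̄ k`, `f̄ = f − πf`; `|γ_k| ≤ 8 C² A ρ^k` under the envelope, so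
`|Γ_f| ≤ 8 C² A ρ/(1−ρ)²`): the stationary double sum is `n σ²_f − 2 Γ_f + 2 Σ' j, (j+1) γ_{j+n+1}`
exactly (`Scoring/BlockSumLeadingBias.sum_sum_dist_eq_leading`), the tail `≤ 8 C² A ρ^{n+1}/(1−ρ)²`;
and each pair expectation from an ARBITRARY start is within `16 C² A² ρ^s ρ^{max(t,t')}` of
`γ_{|t−t'|}` — the pair lemma of the SHARP file with the factor `ρ^s` of the block position KEPT
(tower property twice, `Scoring/ChainTimeAverage.chain_twoTime` + `Scoring/ChainBurnIn.chain_expect`,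
then the envelope at time `s + min(t,t')`), and `Σ_{t,t'<n} ρ^{max} ≤ (1+ρ)/(1−ρ)²`
(`Scoring/ChainMeanSquareError.sum_sum_max`, `sum_range_odd_mul_pow_le`).  So the transient dies with
the block position `s`, the truncation with the block length `n`, and what is left is the universal
constant `−2 Γ_f`.  This is the input of the leading `−2 Γ_f (a+1)/(ab)` bias of the batch-means
estimator (`Scoring/BatchMeansBiasLeading.lean`).  Printed counterpart NAMED ONLY: the bias expansion
of non-overlapping batch means (Goldsman–Meketon 1986; Song–Schmeiser 1995; Chien–Goldsman–Melamed
1997; Flegal–Jones 2010 §2), nothing cited as a fact.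

## Content (envelope `|(kop κ)^[t] g − πg| ≤ 2 C_g A ρ^t`, `0 ≤ ρ < 1`; `|f| ≤ C` measurable;
## `P_{μ₀}` the chain's path law from ANY `μ₀`)

* `abs_leadingBias_le_of_geometricEnvelope` — `|Σ' k, (k+1) γ_{k+1}| ≤ 8 C² A ρ/(1−ρ)²`;
* `abs_chain_pair_sub_autocov_le_start_of_envelope` —
  `|E_{μ₀}[f̄(X_{s+t}) f̄(X_{s+t'})] − γ_{|t−t'|}| ≤ 16 C² A² ρ^s ρ^{max(t,t')}`;
* **`abs_chain_blockSum_sq_sub_leading_le_of_envelope`** — for every `μ₀`, `s`, `n`: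
  `|E_{μ₀}[(Σ_{t<n} f̄(X_{s+t}))²] − (n σ²_f − 2 Σ' k, (k+1) γ_{k+1})|
     ≤ 16 C² A² (1+ρ) ρ^s/(1−ρ)² + 16 C² A ρ^{n+1}/(1−ρ)²`.

NOT CLAIMED: the sign of `Γ_f` for a given sampler; unbounded observables; any `A, ρ` of a concrete
sampler; any number of ours.
-/

noncomputable section

namespace Summit.Ventures.LatticeQCDFlow.Scoring

open MeasureTheory ProbabilityTheory Filter Finset Preorder Literature.Probability.MarkovChains
open scoped ENNReal Topology

variable {Ω : Type*} [MeasurableSpace Ω]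

/-! ### The chain: transient with the block position kept -/

section Envelope

variable {κ : Kernel Ω Ω} [IsMarkovKernel κ] {π : Measure Ω} [IsProbabilityMeasure π] {A ρ : ℝ}

omit [IsMarkovKernel κ] in
/-- `|Γ_f| = |Σ' k, (k+1) γ_{k+1}| ≤ 8 C² A ρ/(1−ρ)²` for the autocovariances of `f̄ = f − πf` under the
envelope (`0 ≤ ρ < 1`). -/
theorem abs_leadingBias_le_of_geometricEnvelope
    (henv : ∀ (g : Ω → ℝ), Measurable g → ∀ (Cg : ℝ), (∀ x, |g x| ≤ Cg) →
      ∀ (t : ℕ) (x : Ω), |(kop κ)^[t] g x - ∫ y, g y ∂π| ≤ 2 * Cg * (A * ρ ^ t))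
    (hρ0 : 0 ≤ ρ) (hρ1 : ρ < 1)
    {f : Ω → ℝ} (hf : Measurable f) {C : ℝ} (hC : ∀ x, |f x| ≤ C) :
    |∑' k : ℕ, ((k : ℝ) + 1) * autocov κ π (fun y => f y - ∫ z, f z ∂π) (k + 1)|
      ≤ 8 * C ^ 2 * A * ρ / (1 - ρ) ^ 2 :=
  abs_tsum_succ_mul_le_of_abs_le_geometric hρ0 hρ1 (abs_autocov_le_of_geometricEnvelope henv hf hC)

variable (μ₀ : Measure Ω) [IsProbabilityMeasure μ₀]

omit [IsProbabilityMeasure π] in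
/-- **Each pair is within `16 C² A² ρ^s ρ^{max(t,t')}` of the stationary autocovariance**, from any
start, WITH the block position `s` kept:
`|E_{μ₀}[f̄(X_{s+t}) f̄(X_{s+t'})] − γ_{|t−t'|}| ≤ 16 C² A² ρ^s ρ^{max(t,t')}` (`f̄` any bounded
measurable observable with `|f̄| ≤ 2C` and the centred decay `|(kop κ)^[k] f̄| ≤ 4 C A ρ^k`). -/
theorem abs_chain_pair_sub_autocov_le_start_of_envelope
    (henv : ∀ (g : Ω → ℝ), Measurable g → ∀ (Cg : ℝ), (∀ x, |g x| ≤ Cg) →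
      ∀ (t : ℕ) (x : Ω), |(kop κ)^[t] g x - ∫ y, g y ∂π| ≤ 2 * Cg * (A * ρ ^ t))
    (hρ0 : 0 ≤ ρ)
    {fb : Ω → ℝ} (hfb : Measurable fb) {C : ℝ} (hC0 : 0 ≤ C) (hCfb : ∀ x, |fb x| ≤ 2 * C)
    (hKfb : ∀ (k : ℕ) (y : Ω), |(kop κ)^[k] fb y| ≤ 2 * (2 * C) * (A * ρ ^ k)) (s t t' : ℕ) :
    |∫ x, fb (x (s + t)) * fb (x (s + t')) ∂(Kernel.trajMeasure (X := fun _ : ℕ => Ω) μ₀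
        (fun n : ℕ => κ.comap (fun h : (i : ↥(Finset.Iic n)) → Ω => h ⟨n, Finset.mem_Iic.2 le_rfl⟩)
          (measurable_pi_apply _)))
      - autocov κ π fb (Nat.dist t t')| ≤ 16 * C ^ 2 * A ^ 2 * ρ ^ s * ρ ^ (max t t') := by
  set P := Kernel.trajMeasure (X := fun _ : ℕ => Ω) μ₀
      (fun n : ℕ => κ.comap (fun h : (i : ↥(Finset.Iic n)) → Ω => h ⟨n, Finset.mem_Iic.2 le_rfl⟩)
        (measurable_pi_apply _)) with hP
  -- the ordered case `t ≤ t'`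
  have hord : ∀ t t', t ≤ t' →
      |∫ x, fb (x (s + t)) * fb (x (s + t')) ∂P - autocov κ π fb (Nat.dist t t')|
        ≤ 16 * C ^ 2 * A ^ 2 * ρ ^ s * ρ ^ (max t t') := by
    intro t t' htt'
    obtain ⟨k, rfl⟩ := Nat.exists_eq_add_of_le htt'
    rw [Nat.dist_eq_sub_of_le htt', Nat.add_sub_cancel_left, max_eq_right htt']
    obtain ⟨hKm, hKb⟩ := iterate_kop_bounded_measurable κ hfb hCfb k
    have hgm : Measurable fun y => fb y * (kop κ)^[k] fb y := hfb.mul hKm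
    have hgb : ∀ y, |fb y * (kop κ)^[k] fb y| ≤ 2 * C * (2 * (2 * C) * (A * ρ ^ k)) := fun y => by
      rw [abs_mul]; exact mul_le_mul (hCfb y) (hKfb k y) (abs_nonneg _) (by linarith [hC0])
    have h1 : ∫ x, fb (x (s + t)) * fb (x (s + (t + k))) ∂P
        = ∫ x, fb (x (s + t)) * (kop κ)^[k] fb (x (s + t)) ∂P := by
      have e : s + (t + k) = s + t + k := by omega
      rw [e]
      exact chain_twoTime κ μ₀ (s + t) hfb hCfb k hfb hCfb
    have h2 : ∫ x, fb (x (s + t)) * (kop κ)^[k] fb (x (s + t)) ∂P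
        = ∫ y, (kop κ)^[s + t] (fun y => fb y * (kop κ)^[k] fb y) y ∂μ₀ :=
      chain_expect κ μ₀ hgm hgb (s + t)
    have hγ : autocov κ π fb k = ∫ y, fb y * (kop κ)^[k] fb y ∂π := rfl
    obtain ⟨hKgm, hKgb⟩ := iterate_kop_bounded_measurable κ hgm hgb (s + t)
    rw [h1, h2, hγ]
    have hsub : ∫ y, (kop κ)^[s + t] (fun y => fb y * (kop κ)^[k] fb y) y ∂μ₀
        - ∫ y, fb y * (kop κ)^[k] fb y ∂π
        = ∫ y, ((kop κ)^[s + t] (fun y => fb y * (kop κ)^[k] fb y) y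
          - ∫ y, fb y * (kop κ)^[k] fb y ∂π) ∂μ₀ := by
      rw [integral_sub (integrable_of_bounded μ₀ hKgm hKgb) (integrable_const _), integral_const,
        probReal_univ, one_smul]
    rw [hsub]
    calc |∫ y, ((kop κ)^[s + t] (fun y => fb y * (kop κ)^[k] fb y) y
            - ∫ y, fb y * (kop κ)^[k] fb y ∂π) ∂μ₀|
        = ‖∫ y, ((kop κ)^[s + t] (fun y => fb y * (kop κ)^[k] fb y) y
            - ∫ y, fb y * (kop κ)^[k] fb y ∂π) ∂μ₀‖ := (Real.norm_eq_abs _).symm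
      _ ≤ 2 * (2 * C * (2 * (2 * C) * (A * ρ ^ k))) * (A * ρ ^ (s + t)) * μ₀.real Set.univ :=
          norm_integral_le_of_norm_le_const (Eventually.of_forall fun y => by
            rw [Real.norm_eq_abs]
            exact henv _ hgm _ hgb (s + t) y)
      _ = 16 * C ^ 2 * A ^ 2 * ρ ^ s * (ρ ^ k * ρ ^ t) := by
          rw [probReal_univ, mul_one, pow_add]; ring
      _ ≤ 16 * C ^ 2 * A ^ 2 * ρ ^ s * ρ ^ (t + k) := by
          refine mul_le_mul_of_nonneg_left (le_of_eq ?_) (by positivity)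
          rw [pow_add, mul_comm]
  rcases le_total t t' with htt' | ht't
  · exact hord t t' htt'
  · have hsym : ∫ x, fb (x (s + t)) * fb (x (s + t')) ∂P = ∫ x, fb (x (s + t')) * fb (x (s + t)) ∂P :=
      integral_congr_ae (ae_of_all _ fun x => by ring)
    rw [hsym, Nat.dist_comm, max_comm]
    exact hord t' t ht't

/-- **THE SECOND MOMENT OF A BLOCK SUM IS `n σ²_f − 2 Γ_f` UP TO GEOMETRICALLY SMALL TERMS IN THE
BLOCK POSITION AND THE BLOCK LENGTH, FROM ANY START, UNDER THE ENVELOPE.**  Envelope `(A, ρ)`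
(`0 ≤ ρ < 1`), `|f| ≤ C` measurable, `f̄ = f − πf`, `γ_k = ∫ f̄ (kop κ)^[k] f̄ dπ`; for EVERY
`μ₀`, `s`, `n`:
`|E_{μ₀}[(Σ_{t<n} f̄(X_{s+t}))²] − (n σ²_f − 2 Σ' k, (k+1) γ_{k+1})| ≤ 16 C² A² (1+ρ) ρ^s/(1−ρ)² + 16 C² A ρ^{n+1}/(1−ρ)²`. -/
theorem abs_chain_blockSum_sq_sub_leading_le_of_envelope
    (henv : ∀ (g : Ω → ℝ), Measurable g → ∀ (Cg : ℝ), (∀ x, |g x| ≤ Cg) →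
      ∀ (t : ℕ) (x : Ω), |(kop κ)^[t] g x - ∫ y, g y ∂π| ≤ 2 * Cg * (A * ρ ^ t))
    (hρ0 : 0 ≤ ρ) (hρ1 : ρ < 1)
    {f : Ω → ℝ} (hf : Measurable f) {C : ℝ} (hC : ∀ x, |f x| ≤ C) (s n : ℕ) :
    |∫ x, (∑ t ∈ Finset.range n, (f (x (s + t)) - ∫ z, f z ∂π)) ^ 2
        ∂(Kernel.trajMeasure (X := fun _ : ℕ => Ω) μ₀
          (fun n : ℕ => κ.comap (fun h : (i : ↥(Finset.Iic n)) → Ω => h ⟨n, Finset.mem_Iic.2 le_rfl⟩)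
            (measurable_pi_apply _)))
      - (n * ((∫ y, (f y - ∫ z, f z ∂π) ^ 2 ∂π)
          + 2 * ∑' k, ∫ y, (f y - ∫ z, f z ∂π) * (kop κ)^[k + 1] (fun y => f y - ∫ z, f z ∂π) y ∂π)
        - 2 * ∑' k : ℕ, ((k : ℝ) + 1)
          * ∫ y, (f y - ∫ z, f z ∂π) * (kop κ)^[k + 1] (fun y => f y - ∫ z, f z ∂π) y ∂π)|
      ≤ 16 * C ^ 2 * A ^ 2 * (1 + ρ) * ρ ^ s / (1 - ρ) ^ 2
        + 16 * C ^ 2 * A * ρ ^ (n + 1) / (1 - ρ) ^ 2 := by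
  set P := Kernel.trajMeasure (X := fun _ : ℕ => Ω) μ₀
      (fun n : ℕ => κ.comap (fun h : (i : ↥(Finset.Iic n)) → Ω => h ⟨n, Finset.mem_Iic.2 le_rfl⟩)
        (measurable_pi_apply _)) with hP
  set c := ∫ z, f z ∂π with hc
  obtain ⟨hfb, hCfb, hfb0⟩ := centred_observable_bounds π hf hC
  have hC0 : 0 ≤ C := (abs_nonneg _).trans (hC (Classical.choice (nonempty_of_isProbabilityMeasure π)))
  have h1ρ : 0 < 1 - ρ := sub_pos.2 hρ1
  have hKfb : ∀ (k : ℕ) (y : Ω), |(kop κ)^[k] (fun z => f z - c) y| ≤ 2 * (2 * C) * (A * ρ ^ k) :=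
    decay_of_geometricEnvelope henv _ hfb (2 * C) hCfb hfb0
  set γ : ℕ → ℝ := fun k => autocov κ π (fun z => f z - c) k with hγdef
  have hγ : ∀ k, |γ k| ≤ 8 * C ^ 2 * A * ρ ^ k := fun k =>
    abs_autocov_le_of_geometricEnvelope henv hf hC k
  -- rewrite `σ²` and `Γ` with `γ`
  have hσ : (∫ y, (f y - c) ^ 2 ∂π)
      + 2 * ∑' k, ∫ y, (f y - c) * (kop κ)^[k + 1] (fun y => f y - c) y ∂π
      = γ 0 + 2 * ∑' k, γ (k + 1) := by
    show _ = autocov κ π (fun z => f z - c) 0 + 2 * ∑' k, autocov κ π (fun z => f z - c) (k + 1)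
    rw [autocov_zero]
    rfl
  have hΓ : ∑' k : ℕ, ((k : ℝ) + 1) * ∫ y, (f y - c) * (kop κ)^[k + 1] (fun y => f y - c) y ∂π
      = ∑' k : ℕ, ((k : ℝ) + 1) * γ (k + 1) := rfl
  rw [hσ, hΓ]
  -- expand the square
  set a : ℕ → (ℕ → Ω) → ℝ := fun t x => f (x (s + t)) - c with ha
  have ham : ∀ t, Measurable (a t) := fun t => hfb.comp (measurable_pi_apply _)
  have hab : ∀ t x, |a t x| ≤ 2 * C := fun t x => hCfb _
  have hiaa : ∀ t t', Integrable (fun x => a t x * a t' x) P := fun t t' =>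
    integrable_of_bounded P ((ham t).mul (ham t')) (C := 2 * C * (2 * C)) fun x => by
      rw [abs_mul]; exact mul_le_mul (hab t x) (hab t' x) (abs_nonneg _) (by positivity)
  have hsq : ∀ x : ℕ → Ω, (∑ t ∈ Finset.range n, a t x) ^ 2
      = ∑ t ∈ Finset.range n, ∑ t' ∈ Finset.range n, a t x * a t' x := fun x => by
    rw [sq, Finset.sum_mul_sum]
  have hE : ∫ x, (∑ t ∈ Finset.range n, a t x) ^ 2 ∂P
      = ∑ t ∈ Finset.range n, ∑ t' ∈ Finset.range n, ∫ x, a t x * a t' x ∂P := by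
    rw [integral_congr_ae (ae_of_all _ hsq), integral_finsetSum _ fun t _ =>
      integrable_finsetSum _ fun t' _ => hiaa t t']
    exact Finset.sum_congr rfl fun t _ => integral_finsetSum _ fun t' _ => hiaa t t'
  show |∫ x, (∑ t ∈ Finset.range n, a t x) ^ 2 ∂P
      - (n * (γ 0 + 2 * ∑' k, γ (k + 1)) - 2 * ∑' k : ℕ, ((k : ℝ) + 1) * γ (k + 1))|
    ≤ 16 * C ^ 2 * A ^ 2 * (1 + ρ) * ρ ^ s / (1 - ρ) ^ 2 + 16 * C ^ 2 * A * ρ ^ (n + 1) / (1 - ρ) ^ 2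
  rw [hE]
  -- (1) the transient: compare with the stationary double sum, keeping `ρ^s`
  have hpairs : |∑ t ∈ Finset.range n, ∑ t' ∈ Finset.range n, ∫ x, a t x * a t' x ∂P
      - ∑ t ∈ Finset.range n, ∑ t' ∈ Finset.range n, γ (Nat.dist t t')|
      ≤ 16 * C ^ 2 * A ^ 2 * ρ ^ s * ((1 + ρ) / (1 - ρ) ^ 2) := by
    rw [← Finset.sum_sub_distrib]
    simp_rw [← Finset.sum_sub_distrib]
    calc |∑ t ∈ Finset.range n, ∑ t' ∈ Finset.range n, (∫ x, a t x * a t' x ∂P - γ (Nat.dist t t'))|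
        ≤ ∑ t ∈ Finset.range n, ∑ t' ∈ Finset.range n, |∫ x, a t x * a t' x ∂P - γ (Nat.dist t t')| :=
          (Finset.abs_sum_le_sum_abs _ _).trans (Finset.sum_le_sum fun t _ =>
            Finset.abs_sum_le_sum_abs _ _)
      _ ≤ ∑ t ∈ Finset.range n, ∑ t' ∈ Finset.range n,
            16 * C ^ 2 * A ^ 2 * ρ ^ s * ρ ^ (max t t') :=
          Finset.sum_le_sum fun t _ => Finset.sum_le_sum fun t' _ =>
            abs_chain_pair_sub_autocov_le_start_of_envelope μ₀ henv hρ0 hfb hC0 hCfb hKfb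
              s t t'
      _ = ∑ k ∈ Finset.range n, (2 * (k : ℝ) + 1) * (16 * C ^ 2 * A ^ 2 * ρ ^ s * ρ ^ k) :=
          sum_sum_max (fun k => 16 * C ^ 2 * A ^ 2 * ρ ^ s * ρ ^ k) n
      _ = 16 * C ^ 2 * A ^ 2 * ρ ^ s * ∑ k ∈ Finset.range n, (2 * (k : ℝ) + 1) * ρ ^ k := by
          rw [Finset.mul_sum]; exact Finset.sum_congr rfl fun k _ => by ring
      _ ≤ 16 * C ^ 2 * A ^ 2 * ρ ^ s * ((1 + ρ) / (1 - ρ) ^ 2) :=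
          mul_le_mul_of_nonneg_left (sum_range_odd_mul_pow_le hρ0 hρ1 n) (by positivity)
  -- (2) the stationary double sum, exactly, and its tail
  have hstat : ∑ t ∈ Finset.range n, ∑ t' ∈ Finset.range n, γ (Nat.dist t t')
      = n * (γ 0 + 2 * ∑' k, γ (k + 1)) - 2 * ∑' k : ℕ, ((k : ℝ) + 1) * γ (k + 1)
        + 2 * ∑' j : ℕ, ((j : ℝ) + 1) * γ (j + n + 1) := by
    have hs : Summable fun k : ℕ => γ (k + 1) := summable_of_abs_le_geometric hρ0 hρ1 hγ 1
    have hs' : Summable fun k : ℕ => ((k : ℝ) + 1) * γ (k + 1) := by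
      have h := summable_succ_mul_of_abs_le_geometric hρ0 hρ1 hγ 0
      simpa only [add_zero] using h
    exact sum_sum_dist_eq_leading hs hs' n
  have htail : |2 * ∑' j : ℕ, ((j : ℝ) + 1) * γ (j + n + 1)| ≤ 16 * C ^ 2 * A * ρ ^ (n + 1) / (1 - ρ) ^ 2 := by
    rw [abs_mul, abs_two]
    calc 2 * |∑' j : ℕ, ((j : ℝ) + 1) * γ (j + n + 1)| ≤ 2 * (8 * C ^ 2 * A * ρ ^ (n + 1) / (1 - ρ) ^ 2) :=
          mul_le_mul_of_nonneg_left
            (abs_tsum_succ_mul_shift_le_of_abs_le_geometric hρ0 hρ1 hγ n) zero_le_two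
      _ = 16 * C ^ 2 * A * ρ ^ (n + 1) / (1 - ρ) ^ 2 := by ring
  -- (3) assemble
  have hsplit : ∑ t ∈ Finset.range n, ∑ t' ∈ Finset.range n, ∫ x, a t x * a t' x ∂P
      - (n * (γ 0 + 2 * ∑' k, γ (k + 1)) - 2 * ∑' k : ℕ, ((k : ℝ) + 1) * γ (k + 1))
      = (∑ t ∈ Finset.range n, ∑ t' ∈ Finset.range n, ∫ x, a t x * a t' x ∂P
          - ∑ t ∈ Finset.range n, ∑ t' ∈ Finset.range n, γ (Nat.dist t t'))
        + 2 * ∑' j : ℕ, ((j : ℝ) + 1) * γ (j + n + 1) := by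
    rw [hstat]; ring
  rw [hsplit]
  calc |(∑ t ∈ Finset.range n, ∑ t' ∈ Finset.range n, ∫ x, a t x * a t' x ∂P
          - ∑ t ∈ Finset.range n, ∑ t' ∈ Finset.range n, γ (Nat.dist t t'))
        + 2 * ∑' j : ℕ, ((j : ℝ) + 1) * γ (j + n + 1)|
      ≤ |∑ t ∈ Finset.range n, ∑ t' ∈ Finset.range n, ∫ x, a t x * a t' x ∂P
          - ∑ t ∈ Finset.range n, ∑ t' ∈ Finset.range n, γ (Nat.dist t t')|
        + |2 * ∑' j : ℕ, ((j : ℝ) + 1) * γ (j + n + 1)| := abs_add_le _ _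
    _ ≤ 16 * C ^ 2 * A ^ 2 * ρ ^ s * ((1 + ρ) / (1 - ρ) ^ 2)
        + 16 * C ^ 2 * A * ρ ^ (n + 1) / (1 - ρ) ^ 2 := add_le_add hpairs htail
    _ = 16 * C ^ 2 * A ^ 2 * (1 + ρ) * ρ ^ s / (1 - ρ) ^ 2
        + 16 * C ^ 2 * A * ρ ^ (n + 1) / (1 - ρ) ^ 2 := by ring

end Envelope

end Summit.Ventures.LatticeQCDFlow.Scoring

end

/-! ## Appendix (row 8, GEN-22): the limit form — the leading constant `−2 Γ_f` is attained from ANY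
start once the block position and the block length both grow: `E_{μ₀}[S²_{s,n}] − n σ²_f → −2 Γ_f`
along `atTop` on `ℕ × ℕ` (both error terms of the theorem above are geometric). -/

noncomputable section

namespace Summit.Ventures.LatticeQCDFlow.Scoring

open MeasureTheory ProbabilityTheory Filter Finset Preorder Literature.Probability.MarkovChains
open scoped Topology

variable {Ω : Type*} [MeasurableSpace Ω] {κ : Kernel Ω Ω} [IsMarkovKernel κ] {π : Measure Ω}
  [IsProbabilityMeasure π] {A ρ : ℝ} (μ₀ : Measure Ω) [IsProbabilityMeasure μ₀] in
/-- **THE LEADING BIAS CONSTANT IS A LIMIT FROM ANY START.**  Envelope `(A, ρ)` (`0 ≤ ρ < 1`),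
`|f| ≤ C` measurable, `f̄ = f − πf`, `γ_k = ∫ f̄ (kop κ)^[k] f̄ dπ`; for every initial law `μ₀`:
`E_{μ₀}[(Σ_{t<n} f̄(X_{s+t}))²] − n σ²_f ⟶ −2 Σ' k, (k+1) γ_{k+1}` as `(s, n) → ∞` in `ℕ × ℕ`
(`σ²_f = ∫ f̄² dπ + 2 Σ' k, γ_{k+1}`). -/
theorem tendsto_chain_blockSum_sq_sub_linear_of_envelope
    (henv : ∀ (g : Ω → ℝ), Measurable g → ∀ (Cg : ℝ), (∀ x, |g x| ≤ Cg) →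
      ∀ (t : ℕ) (x : Ω), |(kop κ)^[t] g x - ∫ y, g y ∂π| ≤ 2 * Cg * (A * ρ ^ t))
    (hρ0 : 0 ≤ ρ) (hρ1 : ρ < 1)
    {f : Ω → ℝ} (hf : Measurable f) {C : ℝ} (hC : ∀ x, |f x| ≤ C) :
    Tendsto (fun sn : ℕ × ℕ =>
      ∫ x, (∑ t ∈ Finset.range sn.2, (f (x (sn.1 + t)) - ∫ z, f z ∂π)) ^ 2
          ∂(Kernel.trajMeasure (X := fun _ : ℕ => Ω) μ₀
            (fun n : ℕ => κ.comap (fun h : (i : ↥(Finset.Iic n)) → Ω => h ⟨n, Finset.mem_Iic.2 le_rfl⟩)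
              (measurable_pi_apply _)))
        - sn.2 * ((∫ y, (f y - ∫ z, f z ∂π) ^ 2 ∂π)
          + 2 * ∑' k, ∫ y, (f y - ∫ z, f z ∂π) * (kop κ)^[k + 1] (fun y => f y - ∫ z, f z ∂π) y ∂π))
      atTop
      (𝓝 (-(2 * ∑' k : ℕ, ((k : ℝ) + 1)
          * ∫ y, (f y - ∫ z, f z ∂π) * (kop κ)^[k + 1] (fun y => f y - ∫ z, f z ∂π) y ∂π))) := by
  set P := Kernel.trajMeasure (X := fun _ : ℕ => Ω) μ₀
      (fun n : ℕ => κ.comap (fun h : (i : ↥(Finset.Iic n)) → Ω => h ⟨n, Finset.mem_Iic.2 le_rfl⟩)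
        (measurable_pi_apply _)) with hP
  set σ2 : ℝ := (∫ y, (f y - ∫ z, f z ∂π) ^ 2 ∂π)
      + 2 * ∑' k, ∫ y, (f y - ∫ z, f z ∂π) * (kop κ)^[k + 1] (fun y => f y - ∫ z, f z ∂π) y ∂π
    with hσ2
  set Γ : ℝ := ∑' k : ℕ, ((k : ℝ) + 1)
      * ∫ y, (f y - ∫ z, f z ∂π) * (kop κ)^[k + 1] (fun y => f y - ∫ z, f z ∂π) y ∂π with hΓ
  set E : ℕ × ℕ → ℝ := fun sn =>
    ∫ x, (∑ t ∈ Finset.range sn.2, (f (x (sn.1 + t)) - ∫ z, f z ∂π)) ^ 2 ∂P with hE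
  -- the two geometric error terms of the theorem, as a function of `(s, n)`
  set K₁ : ℝ := 16 * C ^ 2 * A ^ 2 * (1 + ρ) / (1 - ρ) ^ 2 with hK₁
  set K₂ : ℝ := 16 * C ^ 2 * A * ρ / (1 - ρ) ^ 2 with hK₂
  have hbound : ∀ sn : ℕ × ℕ, |E sn - sn.2 * σ2 - (-(2 * Γ))| ≤ K₁ * ρ ^ sn.1 + K₂ * ρ ^ sn.2 := by
    rintro ⟨s, n⟩
    have h0 := abs_chain_blockSum_sq_sub_leading_le_of_envelope μ₀ henv hρ0 hρ1 hf hC s n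
    rw [← hP] at h0
    have e1 : E (s, n) - ((s, n) : ℕ × ℕ).2 * σ2 - (-(2 * Γ)) = E (s, n) - (n * σ2 - 2 * Γ) := by ring
    have e2 : 16 * C ^ 2 * A ^ 2 * (1 + ρ) * ρ ^ s / (1 - ρ) ^ 2
        + 16 * C ^ 2 * A * ρ ^ (n + 1) / (1 - ρ) ^ 2 = K₁ * ρ ^ s + K₂ * ρ ^ n := by
      rw [hK₁, hK₂, pow_succ]; ring
    rw [e1, ← e2]
    simpa only [hE, hσ2, hΓ] using h0
  -- both error terms tend to `0` along `atTop` on `ℕ × ℕ`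
  have hρ := tendsto_pow_atTop_nhds_zero_of_lt_one hρ0 hρ1
  have h1' : Tendsto (fun sn : ℕ × ℕ => ρ ^ sn.1) (atTop ×ˢ atTop) (𝓝 0) := hρ.comp tendsto_fst
  have h2' : Tendsto (fun sn : ℕ × ℕ => ρ ^ sn.2) (atTop ×ˢ atTop) (𝓝 0) := hρ.comp tendsto_snd
  rw [prod_atTop_atTop_eq] at h1' h2'
  have h1 : Tendsto (fun sn : ℕ × ℕ => K₁ * ρ ^ sn.1) atTop (𝓝 0) := by
    simpa using h1'.const_mul K₁
  have h2 : Tendsto (fun sn : ℕ × ℕ => K₂ * ρ ^ sn.2) atTop (𝓝 0) := by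
    simpa using h2'.const_mul K₂
  have hsum : Tendsto (fun sn : ℕ × ℕ => K₁ * ρ ^ sn.1 + K₂ * ρ ^ sn.2) atTop (𝓝 0) := by
    simpa using h1.add h2
  -- squeeze
  have hdiff : Tendsto (fun sn : ℕ × ℕ => E sn - sn.2 * σ2 - (-(2 * Γ))) atTop (𝓝 0) :=
    squeeze_zero_norm (fun sn => by simpa only [Real.norm_eq_abs] using hbound sn) hsum
  have := hdiff.add_const (-(2 * Γ))
  simpa only [sub_add_cancel, zero_add, hE] using this

end Summit.Ventures.LatticeQCDFlow.Scoring

end
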